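import Summits.Ventures.GridStability.Models.StructurePreservingDAEHessian
import HarnessLib

/-!
# GridStability/Models/StructurePreservingDAELocalMin — positive second variation on the pinned slice
# ⇒ the operating point is a STRICT LOCAL MINIMUM of the structure-preserving energy modulo rotation

LADDER-GRIDFUSION G3 (model register), seat gridfusion-model-2 (g9); `plan/MODEL-VALIDITY.md` row
**MV-4** (c). Input: `StructurePreservingDAEHessian.lean` (potential, first/second variation along a
line, rotation zero mode). Second-order sufficiency for the energy of [cite: Padiyar2013, §3.4.4
eq (3.32)] at an operating point — the hypothesis «`c‖y‖² ≤ V(y)`» of [cite: HairerNorsettWanner1993,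
§I.13 eq (13.17)] in the only form available for `W` (which has the uniform-rotation zero mode):
strictness on the slice where one bus angle is pinned.

## Contents (all PROVED; MODELLED column — statements about MODEL MV-4; no instance, no grid sentence)
* `SmoothLoads` — the load regularity the second-order analysis needs: constant active loads
  (Padiyar Comment 2 / (3.41)), reactive characteristics differentiable on `(0, ∞)` with a
  derivative field `Q′_L` continuous there (every ZIP / exponential row of `Models/Loads.lean`).
* `potential_lt_of_hessianQuad_pos` — **second-order sufficiency on the pinned slice**: at an
  operating point with `V* > 0`, if the second variation `hessianQuad` is POSITIVE on every nonzero
  direction `(a, u, φ)` with `φ k₀ = 0` (bus `k₀` pinned — the rotation zero mode removed), then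
  `W − W₁` is strictly larger at every other state of the slice within sup-distance `r` (segment
  argument: along `σ ↦ x* + σd` the first variation vanishes at `0` and has positive derivative near
  `0`, uniformly on the compact unit sphere of pinned directions by the tube lemma).
* `energy_lt_of_hessianQuad_pos` — the same for `W` itself (kinetic term `½ΣMᵢ(ωᵢ−ω_s)²`, `Mᵢ > 0`).
The stability consequence (Liapunov stability modulo rotation for DAE motions) is the companion
`StructurePreservingDAEStability.lean`. THREE COLUMNS: this is the lemma that turns a CERTIFIED
positive-definiteness certificate of the pinned Hessian at an operating point into a strict-minimum
sentence about MODEL MV-4. [cite: Padiyar2013, §3.4.4 eqs (3.32)–(3.41)]; [cite: SauerPai1998, §9.8]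
-/

noncomputable section

open Finset Real Set Metric Filter
open scoped Topology

namespace Summit.Ventures.GridStability.Models.StructurePreservingDAE.Params

variable {m n : ℕ}

/-- Load regularity for the second-order analysis of MODEL MV-4: CONSTANT active loads
(`P_Lk(v) = P_Lk(V*_k)`, [cite: Padiyar2013, §3.4.4 Comment 2]) and reactive characteristics `Q_Lk`
differentiable at every `v > 0` with derivative `Q′_Lk(v)`, the derivative field being continuous on
`(0, ∞)` (ZIP, exponential, constant Z/I/P rows of `Models/Loads.lean`). -/
structure SmoothLoads (p : Params m n) (Vs : Fin n → ℝ) (QL' : Fin n → ℝ → ℝ) : Prop where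
  PL_const : ∀ k v, p.PL k v = p.PL k (Vs k)
  QL_hasDerivAt : ∀ k v, 0 < v → HasDerivAt (p.QL k) (QL' k v) v
  QL'_continuousOn : ∀ k, ContinuousOn (QL' k) (Ioi 0)

namespace SmoothLoads

/-- Differentiable reactive characteristics are continuous on `(0, ∞)`. -/
theorem QL_continuousOn {p : Params m n} {Vs : Fin n → ℝ} {QL' : Fin n → ℝ → ℝ}
    (h : p.SmoothLoads Vs QL') (k : Fin n) : ContinuousOn (p.QL k) (Ioi 0) :=
  fun v hv => (h.QL_hasDerivAt k v hv).continuousAt.continuousWithinAt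

end SmoothLoads

/-! ### Second-order sufficiency: positive second variation on the pinned slice ⇒ strict minimum -/

/-- **Positive second variation on the pinned directions ⇒ strict local minimum of `W − W₁` on the
pinned slice.** `B` symmetric, `(δ*, V*, θ*)` an operating point with `V* > 0` (reference voltages
`V*`), smooth loads; if `hessianQuad` at the operating point is positive on every nonzero direction
`(a, u, φ)` with `φ k₀ = 0`, then there is `r > 0` such that `W − W₁` at `(δ* + a, V* + u, θ* + φ)`
exceeds its value at the operating point for every such direction of sup-norm `< r`.
[cite: Padiyar2013, §3.4.4 eqs (3.32)–(3.37); HairerNorsettWanner1993, §I.13 eq (13.17)] -/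
theorem potential_lt_of_hessianQuad_pos {p : Params m n} (hB : ∀ k l, p.B k l = p.B l k)
    {δs : Fin m → ℝ} {Vs θs : Fin n → ℝ} (hop : p.IsOperatingPoint δs Vs θs) (hVs : ∀ k, 0 < Vs k)
    {QL' : Fin n → ℝ → ℝ} (hL : p.SmoothLoads Vs QL') (k₀ : Fin n)
    (hpos : ∀ (a : Fin m → ℝ) (u φ : Fin n → ℝ), φ k₀ = 0 → (a, u, φ) ≠ 0 →
      0 < p.hessianQuad QL' δs a Vs θs u φ) :
    ∃ r > 0, ∀ (a : Fin m → ℝ) (u φ : Fin n → ℝ), φ k₀ = 0 → (a, u, φ) ≠ 0 →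
      ‖((a, u, φ) : (Fin m → ℝ) × (Fin n → ℝ) × (Fin n → ℝ))‖ < r →
      p.potential Vs δs Vs θs
        < p.potential Vs (fun i => δs i + a i) (fun k => Vs k + u k) (fun k => θs k + φ k) := by
  -- the second variation along the line `σ ↦ x* + σ d`, as a function of `(σ, d)`
  set F : ℝ × ((Fin m → ℝ) × (Fin n → ℝ) × (Fin n → ℝ)) → ℝ := fun z =>
    p.hessianQuad QL' (fun i => δs i + z.1 * z.2.1 i) z.2.1 (fun k => Vs k + z.1 * z.2.2.1 k)
      (fun k => θs k + z.1 * z.2.2.2 k) z.2.2.1 z.2.2.2 with hFdef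
  set U : Set (ℝ × ((Fin m → ℝ) × (Fin n → ℝ) × (Fin n → ℝ))) :=
    {z | ∀ k, 0 < Vs k + z.1 * z.2.2.1 k} with hUdef
  have hUo : IsOpen U := by
    rw [hUdef, show {z : ℝ × ((Fin m → ℝ) × (Fin n → ℝ) × (Fin n → ℝ)) |
        ∀ k, 0 < Vs k + z.1 * z.2.2.1 k} = ⋂ k, {z | 0 < Vs k + z.1 * z.2.2.1 k} by ext z; simp]
    exact isOpen_iInter_of_finite fun k => isOpen_lt continuous_const (by fun_prop)
  -- `F` is continuous on `U`
  have hFc : ContinuousOn F U := by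
    have hV : ∀ k, Continuous fun z : ℝ × ((Fin m → ℝ) × (Fin n → ℝ) × (Fin n → ℝ)) =>
        Vs k + z.1 * z.2.2.1 k := fun k => by fun_prop
    have hload : ContinuousOn (fun z : ℝ × ((Fin m → ℝ) × (Fin n → ℝ) × (Fin n → ℝ)) =>
        ∑ k, (QL' k (Vs k + z.1 * z.2.2.1 k) * (Vs k + z.1 * z.2.2.1 k)
          - p.QL k (Vs k + z.1 * z.2.2.1 k)) / (Vs k + z.1 * z.2.2.1 k) ^ 2 * z.2.2.1 k ^ 2) U := by
      refine continuousOn_finsetSum _ fun k _ => ?_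
      have hmaps : MapsTo (fun z : ℝ × ((Fin m → ℝ) × (Fin n → ℝ) × (Fin n → ℝ)) =>
          Vs k + z.1 * z.2.2.1 k) U (Ioi 0) := fun z hz => hz k
      have h1 : ContinuousOn (fun z : ℝ × ((Fin m → ℝ) × (Fin n → ℝ) × (Fin n → ℝ)) =>
          QL' k (Vs k + z.1 * z.2.2.1 k)) U := (hL.QL'_continuousOn k).comp (hV k).continuousOn hmaps
      have h2 : ContinuousOn (fun z : ℝ × ((Fin m → ℝ) × (Fin n → ℝ) × (Fin n → ℝ)) =>
          p.QL k (Vs k + z.1 * z.2.2.1 k)) U := (hL.QL_continuousOn k).comp (hV k).continuousOn hmaps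
      refine ((((h1.mul (hV k).continuousOn).sub h2).div ((hV k).continuousOn.pow 2)
        fun z hz => pow_ne_zero 2 (hz k).ne')).mul (Continuous.continuousOn (by fun_prop))
    have hsmooth : Continuous fun z : ℝ × ((Fin m → ℝ) × (Fin n → ℝ) × (Fin n → ℝ)) =>
        ∑ i, (2 * z.2.2.1 (p.bus i) ^ 2
          + 2 * p.E i * (2 * z.2.2.1 (p.bus i) * (z.2.1 i - z.2.2.2 (p.bus i))
              * Real.sin (δs i + z.1 * z.2.1 i - (θs (p.bus i) + z.1 * z.2.2.2 (p.bus i)))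
            + (Vs (p.bus i) + z.1 * z.2.2.1 (p.bus i)) * (z.2.1 i - z.2.2.2 (p.bus i)) ^ 2
              * Real.cos (δs i + z.1 * z.2.1 i - (θs (p.bus i) + z.1 * z.2.2.2 (p.bus i)))))
          / (2 * p.Xd' i)
        + -(1 / 2) * ∑ k, ∑ l, p.B k l * (2 * z.2.2.1 k * z.2.2.1 l
              * Real.cos (θs k + z.1 * z.2.2.2 k - (θs l + z.1 * z.2.2.2 l))
            - 2 * (z.2.2.1 k * (Vs l + z.1 * z.2.2.1 l) + (Vs k + z.1 * z.2.2.1 k) * z.2.2.1 l)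
              * (z.2.2.2 k - z.2.2.2 l) * Real.sin (θs k + z.1 * z.2.2.2 k - (θs l + z.1 * z.2.2.2 l))
            - (Vs k + z.1 * z.2.2.1 k) * (Vs l + z.1 * z.2.2.1 l) * (z.2.2.2 k - z.2.2.2 l) ^ 2
              * Real.cos (θs k + z.1 * z.2.2.2 k - (θs l + z.1 * z.2.2.2 l))) := by
      fun_prop
    have h := hsmooth.continuousOn.sub hload (s := U)
    refine h.congr fun z _ => ?_
    simp only [hFdef, hessianQuad, Pi.sub_apply]
  -- the compact set of pinned unit directions
  set K : Set ((Fin m → ℝ) × (Fin n → ℝ) × (Fin n → ℝ)) := {d | ‖d‖ = 1 ∧ d.2.2 k₀ = 0} with hKdef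
  have hKc : IsCompact K := by
    refine (isCompact_closedBall (0 : (Fin m → ℝ) × (Fin n → ℝ) × (Fin n → ℝ)) 1).of_isClosed_subset
      ?_ fun d hd => mem_closedBall.2 (by rw [dist_zero_right]; exact hd.1.le)
    exact (isClosed_eq continuous_norm continuous_const).inter
      (isClosed_eq (by fun_prop) continuous_const)
  -- at `σ = 0` the second variation is positive on `K`, hence nearby, uniformly on `K`
  have hev : ∀ᶠ σ in 𝓝 (0 : ℝ), ∀ d ∈ K, 0 < F (σ, d) ∧ (σ, d) ∈ U := by
    refine hKc.eventually_forall_of_forall_eventually fun d hd => ?_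
    have hU0 : ((0 : ℝ), d) ∈ U := fun k => by simpa using hVs k
    have hd0 : d ≠ 0 := fun h => by simp [h, hKdef] at hd
    have hF0 : 0 < F (0, d) := by
      have := hpos d.1 d.2.1 d.2.2 hd.2 (by simpa using hd0)
      simpa [hFdef] using this
    have h1 : ∀ᶠ z in 𝓝 ((0 : ℝ), d), 0 < F z :=
      (hFc.continuousAt (hUo.mem_nhds hU0)).eventually_mem (Ioi_mem_nhds hF0)
    have h2 : ∀ᶠ z in 𝓝 ((0 : ℝ), d), z ∈ U := hUo.mem_nhds hU0
    exact h1.and h2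
  obtain ⟨r, hr, hrF⟩ : ∃ r > 0, ∀ σ : ℝ, |σ| < r → ∀ d ∈ K, 0 < F (σ, d) ∧ (σ, d) ∈ U := by
    rcases Metric.eventually_nhds_iff.1 hev with ⟨r, hr, h⟩
    exact ⟨r, hr, fun σ hσ => h (by simpa [Real.dist_eq] using hσ)⟩
  refine ⟨r, hr, fun a u φ hφ hne hnorm => ?_⟩
  -- normalise the direction
  set N : ℝ := ‖((a, u, φ) : (Fin m → ℝ) × (Fin n → ℝ) × (Fin n → ℝ))‖ with hNdef
  have hNpos : 0 < N := norm_pos_iff.2 hne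
  set e : (Fin m → ℝ) × (Fin n → ℝ) × (Fin n → ℝ) := (N⁻¹ • a, N⁻¹ • u, N⁻¹ • φ) with hedef
  have heK : e ∈ K := by
    refine ⟨?_, ?_⟩
    · have : e = N⁻¹ • ((a, u, φ) : (Fin m → ℝ) × (Fin n → ℝ) × (Fin n → ℝ)) := by
        simp [hedef]
      rw [this, norm_smul, norm_inv, norm_norm, inv_mul_cancel₀ hNpos.ne']
    · simp [hedef, hφ]
  -- the one-variable functions along the normalised direction
  set g : ℝ → ℝ := fun σ => p.potential Vs (fun i => δs i + σ * e.1 i)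
    (fun k => Vs k + σ * e.2.1 k) (fun k => θs k + σ * e.2.2 k) with hgdef
  set g' : ℝ → ℝ := fun σ => p.potentialRate (fun i => δs i + σ * e.1 i) e.1
    (fun k => Vs k + σ * e.2.1 k) (fun k => θs k + σ * e.2.2 k) e.2.1 e.2.2 with hg'def
  have hVσ : ∀ σ, |σ| < r → ∀ k, 0 < Vs k + σ * e.2.1 k := fun σ hσ => (hrF σ hσ e heK).2
  have hg1 : ∀ σ, |σ| < r → HasDerivAt g (g' σ) σ := fun σ hσ =>
    hasDerivAt_potential_line hB (hVσ σ hσ) hVs hL.PL_const hL.QL_continuousOn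
  have hg2 : ∀ σ, |σ| < r → HasDerivAt g' (F (σ, e)) σ := fun σ hσ =>
    hasDerivAt_potentialRate_line (hVσ σ hσ) hL.PL_const
      (fun k => hL.QL_hasDerivAt k _ (hVσ σ hσ k))
  have habs : ∀ σ ∈ Ico (0 : ℝ) r, |σ| < r := fun σ hσ => by
    rw [abs_of_nonneg hσ.1]; exact hσ.2
  -- `g'` increases strictly on `[0, r)` and vanishes at `0`
  have hg'mono : StrictMonoOn g' (Ico 0 r) := by
    refine strictMonoOn_of_deriv_pos (convex_Ico 0 r)
      (fun σ hσ => (hg2 σ (habs σ hσ)).continuousAt.continuousWithinAt) fun σ hσ => ?_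
    rw [interior_Ico] at hσ
    rw [(hg2 σ (habs σ (Ioo_subset_Ico_self hσ))).deriv]
    exact (hrF σ (habs σ (Ioo_subset_Ico_self hσ)) e heK).1
  have hg'0 : g' 0 = 0 := by
    simp only [hg'def, zero_mul, add_zero]
    exact potentialRate_eq_zero_of_isOperatingPoint hB hop (fun k => (hVs k).ne') _ _ _
  have hg'pos : ∀ σ ∈ Ioo (0 : ℝ) r, 0 < deriv g σ := by
    intro σ hσ
    rw [(hg1 σ (habs σ (Ioo_subset_Ico_self hσ))).deriv, ← hg'0]
    exact hg'mono ⟨le_rfl, hr⟩ (Ioo_subset_Ico_self hσ) hσ.1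
  have hgmono : StrictMonoOn g (Ico 0 r) := by
    refine strictMonoOn_of_deriv_pos (convex_Ico 0 r)
      (fun σ hσ => (hg1 σ (habs σ hσ)).continuousAt.continuousWithinAt) fun σ hσ => ?_
    rw [interior_Ico] at hσ
    exact hg'pos σ hσ
  -- evaluate at `σ = N = ‖(a, u, φ)‖`
  have hlt := hgmono ⟨le_rfl, hr⟩ ⟨hNpos.le, hnorm⟩ hNpos
  have hscal : ∀ x : ℝ, N * (N⁻¹ * x) = x := fun x => by
    rw [← mul_assoc, mul_inv_cancel₀ hNpos.ne', one_mul]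
  have hg0 : g 0 = p.potential Vs δs Vs θs := by
    simp only [hgdef, zero_mul, add_zero]
  have hgN : g N = p.potential Vs (fun i => δs i + a i) (fun k => Vs k + u k)
      (fun k => θs k + φ k) := by
    simp only [hgdef, hedef, Pi.smul_apply, smul_eq_mul, hscal]
  rw [hg0, hgN] at hlt
  exact hlt

/-- **The same for the full energy `W`** (directions `(a, α, u, φ)` in `(δ, ω, V, θ)`): with
`Mᵢ > 0` the kinetic term is nonnegative and vanishes only at `ω = ω_s`, so `W` at
`(δ* + a, ω_s + α, V* + u, θ* + φ)` exceeds `W` at the operating point for every nonzero pinned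
direction of sup-norm `< r`. [cite: Padiyar2013, §3.4.4 eq (3.32)] -/
theorem energy_lt_of_hessianQuad_pos {p : Params m n} (hp : p.WellFormed)
    {δs : Fin m → ℝ} {Vs θs : Fin n → ℝ} (hop : p.IsOperatingPoint δs Vs θs) (hVs : ∀ k, 0 < Vs k)
    {QL' : Fin n → ℝ → ℝ} (hL : p.SmoothLoads Vs QL') (k₀ : Fin n)
    (hpos : ∀ (a : Fin m → ℝ) (u φ : Fin n → ℝ), φ k₀ = 0 → (a, u, φ) ≠ 0 →
      0 < p.hessianQuad QL' δs a Vs θs u φ) :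
    ∃ r > 0, ∀ (a α : Fin m → ℝ) (u φ : Fin n → ℝ), φ k₀ = 0 → (a, α, u, φ) ≠ 0 →
      ‖((a, α, u, φ) : (Fin m → ℝ) × (Fin m → ℝ) × (Fin n → ℝ) × (Fin n → ℝ))‖ < r →
      p.energy Vs δs (fun _ => p.ωs) Vs θs
        < p.energy Vs (fun i => δs i + a i) (fun i => p.ωs + α i) (fun k => Vs k + u k)
            (fun k => θs k + φ k) := by
  obtain ⟨r, hr, h⟩ := potential_lt_of_hessianQuad_pos hp.B_symm hop hVs hL k₀ hpos
  refine ⟨r, hr, fun a α u φ hφ hne hnorm => ?_⟩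
  have hkin0 : p.kinetic (fun _ => p.ωs) = 0 := by simp [kinetic]
  have hkin : 0 ≤ p.kinetic (fun i => p.ωs + α i) := by
    unfold kinetic
    refine mul_nonneg (by norm_num) (Finset.sum_nonneg fun i _ => mul_nonneg ?_ (sq_nonneg _))
    exact (div_pos (mul_pos two_pos (hp.H_pos i)) hp.ωs_pos).le
  rw [energy_eq_kinetic_add_potential, energy_eq_kinetic_add_potential, hkin0, zero_add]
  by_cases hauφ : ((a, u, φ) : (Fin m → ℝ) × (Fin n → ℝ) × (Fin n → ℝ)) = 0
  · -- only the speeds move: the kinetic term is positive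
    obtain ⟨ha, hu, hφ0⟩ : a = 0 ∧ u = 0 ∧ φ = 0 := by simpa [Prod.ext_iff] using hauφ
    have hα : α ≠ 0 := by
      rintro rfl
      exact hne (by simp [ha, hu, hφ0])
    obtain ⟨i, hi⟩ : ∃ i, α i ≠ 0 := by
      by_contra hall
      push Not at hall
      exact hα (funext hall)
    have hkpos : 0 < p.kinetic (fun i => p.ωs + α i) := by
      unfold kinetic
      refine mul_pos (by norm_num) (Finset.sum_pos' (fun j _ => mul_nonneg ?_ (sq_nonneg _))
        ⟨i, Finset.mem_univ _, mul_pos ?_ ?_⟩)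
      · exact (div_pos (mul_pos two_pos (hp.H_pos j)) hp.ωs_pos).le
      · exact div_pos (mul_pos two_pos (hp.H_pos i)) hp.ωs_pos
      · have : p.ωs + α i - p.ωs = α i := by ring
        rw [this]
        positivity
    subst ha hu hφ0
    simp only [Pi.zero_apply, add_zero]
    linarith
  · have hn3 : ‖((a, u, φ) : (Fin m → ℝ) × (Fin n → ℝ) × (Fin n → ℝ))‖ < r := by
      refine lt_of_le_of_lt ?_ hnorm
      simp only [Prod.norm_mk]
      exact max_le (le_max_left _ _) ((le_max_right _ _).trans (le_max_right _ _))
    have hlt := h a u φ hφ hauφ hn3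
    linarith

end Summit.Ventures.GridStability.Models.StructurePreservingDAE.Params

end
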